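/-
Origin: expansion seat `planner-pub-hodgecm-mc-theta-3-g12-0`, handover (LS) 2026-08-20T05:34:10Z md5 1d4eccc3cba8a2ae4d23fca50ab8017e (302 l.; NEW additive leaf over (SD) [this kit] + installed RUN-41 (CF) `ArchLineCenterCharClosedForm` + binder-2 `HypCensus.DefiniteVacuumExponent`/`ArchDatumBlockFramesCM`; the line pair's `hslot` family: `exists_lineSlotDatum_of_ne` (off v₁, no hypothesis), `exists_lineSlotDatum_cmPlace_of_pos` (at v₁, positively read line), `lineSlotFamily_of_cmPlace`/`_of_pos`, hypothesis-reduced (CF) closed forms `coe_lineCenterChar_eq_prod_zpow_of_cmPlace`/`_of_pos`, (F1)-currency `lineSlotFamily_of_hpos`/`lineC_eq_prod_zpow_mul_of_hpos`; cert rc 0/34 s/0 warn/0 proof-hole; axioms 16/16 ⊆ trio) (`HOME/mc/pub-hodgecm-mc-theta-3-g12/lean/stage42/HodgeCM/Model/ArchLineSlotDatum.lean`, md5 1d4eccc3cba8, 302 lines);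
landed by the second packager p2 gen 3 (p2-g3) in gate run 42 as `HodgeCM/Model/ArchLineSlotDatum.lean` (verbatim).
-/
/-
Origin: speedrun cell pub-hodgecm, MODEL-CONSTRUCTION sub-cell, lineage mc-theta-3 (BINDER-OWNERS row 5, the `𝔄` slot),
seat planner-pub-hodgecm-mc-theta-3-g12-0 (gen 12), 2026-08-20.  Target in PKG: `HodgeCM/Model/ArchLineSlotDatum.lean`
(NEW additive leaf over `HodgeCM.Model.ArchSlotDatumDefinite` (SD) + `HodgeCM.Model.ArchLineCenterCharClosedForm` (CF)).
KERNEL only: 0 records / named facts / proof holes.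
-/
import Summits.HodgeConjecture.HodgeCM.Model.ArchSlotDatumDefinite
import Summits.HodgeConjecture.HodgeCM.Model.ArchLineCenterCharClosedForm
import Summits.HodgeConjecture.HodgeCM.Model.HypCensus.DefiniteVacuumExponent_2
import Summits.HodgeConjecture.HodgeCM.Model.HypCensus.ArchDatumBlockFramesCM

/-!
# The small-datum hypothesis `hslot` of the LINE pair, discharged

Binder-2's `placeVacExponents` (and hence (CF)'s closed form `coe_lineCenterChar_eq_prod_zpow` of the line's centre
character) carries ONE hypothesis that is not kernel data of the pin: at every real place `v` of `L⁺` a small Weil datum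
`hslot v : ∃ ω₁, IsArchWeilDatum (ι𝕎 (P_v) (Q_v) (R_v) (S_v)) ω₁ ∧ ∀ u, Continuous (ω₁ u)` on the canonical slot
`Ginf` of the pair `(V, ⟨d⟩)` at `v` (the exponents themselves are read off the GLOBAL datum; the small datum only
certifies that the place is a dual-pair slot).  This leaf discharges it from KERNEL facts:

* §1 (generic CM pin `(d_V, d_W)`): a `W`-family of constant strict sign through the embedding over `v` reads DOUBLY
  DEFINITE in the canonical frame (`isEmpty_posIdx_or_negIdx_cmXW_of_signs`); a LINE (`M = 1`) does so at EVERY real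
  place (`isEmpty_posIdx_or_negIdx_cmXW_lineVec`);
* §2 (the line pair of a `HermSpace3`): off the place `v₁` under `ι₁` the `V`-side is definite too
  (`frameD_sign_of_ne`), so the slot at `v ≠ v₁` is a product of two COMPACT unitary groups and (SD)
  `exists_slotDatum_of_definite` supplies the datum — `exists_lineSlotDatum_of_ne`, NO hypothesis; at `v₁` the `V`-side
  reads `(2,1)` (`cmPosIdxEquivFin` / `cmNegIdxEquivUnit` of binder-2), so a POSITIVELY read line (`R_{v₁}` non-empty)
  is (SD)'s `exists_slotDatum_of_negCard` — `exists_lineSlotDatum_cmPlace_of_pos`;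
* §3 hence the whole place family `hslot` REDUCES to the single place `v₁` (`lineSlotFamily_of_cmPlace`) and is
  UNCONDITIONAL for a positively read line (`lineSlotFamily_of_pos`); the corresponding hypothesis-reduced forms of
  (CF)'s `lineVacExponents` / `coe_lineCenterChar_eq_prod_zpow` / `lineC_eq_prod_zpow_mul` are recorded
  (`…_of_cmPlace`, `…_of_pos`);
* §4 the same in (F1)'s currency `hpos : 0 < x_W(v₁) 0` (the hypothesis text of `archLineDatumOf`):
  `lineSlotFamily_of_hpos`, and (F1)'s eigenvalue in closed form `lineC_eq_prod_zpow_mul_of_hpos` — under `hpos` ALONE.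

The negatively read line at `v₁` (`V ≅ (2,1)`, `W ≅ (0,1)`) is NOT covered here: K-1's explicit vacuum-overlap phase
(`vacuumOverlapPhase_neg_card`) is stated for `[Nonempty R] [IsEmpty S]` only; that case keeps `hslot v₁` as a hypothesis
(row 5 (`𝔄`) only ever instantiates positively read lines, cf. carch-1's `(R := Unit) (S := Empty)`).
[Weil1964, Chap. I n° 12; Folland1989, Prop. (4.39); KonnoKonno2007, §3.1 (3.1), Lemma 5.2 — orientation only, nothing
enters as a hypothesis-fact.]
-/

set_option autoImplicit false

noncomputable section

open NumberField NumberField.InfinitePlace NumberField.mixedEmbedding IsDedekindDomain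
open scoped Matrix Kronecker Classical TensorProduct ComplexConjugate SchwartzMap
open MvPolynomial
open Literature.NumberTheory.Automorphic Literature.NumberTheory.Automorphic.UnitaryGroup Literature.NumberTheory.Weil1964
open Literature.RepresentationTheory.KonnoKonno2007 Literature.RepresentationTheory.KonnoKonno2007.RealDualPair
open Literature.NumberTheory.GelbartRogawski1991 Literature.NumberTheory.GelbartRogawski1991.UnitaryDualPair
open Literature.Analysis.SegalBargmann
open HodgeCM.Adelic HodgeCM.PerL34 HodgeCM.Model.HypCensus HodgeCM.Model.SupplyInstance

namespace HodgeCM.Model.ArchSideTerm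

/-! ## §1 Generic CM pin: a constant-sign `W`-family reads doubly definite -/

section Generic

variable (L : Type) [Field L] [NumberField L] [IsCMField L] {N M : ℕ}
variable (dV : Fin N → L) (dW : Fin M → L) (hdW : ∀ j, IsCMField.complexConj L (dW j) = dW j) (ι₁ : L →+* ℂ)

/-- **a `W`-family of constant strict sign through the complex embedding `τ` over `v` reads doubly definite** in the
canonical `W`-frame at `v`: no positive index or no non-positive index. [folklore] -/
theorem isEmpty_posIdx_or_negIdx_cmXW_of_signs (v : {v : InfinitePlace ↥(maximalRealSubfield L) // v.IsReal})
    (τ : L →+* ℂ) (hτ : (InfinitePlace.mk τ).comap (algebraMap (↥(maximalRealSubfield L)) L) = v.1)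
    (h : (∀ j, 0 < (τ (dW j)).re) ∨ ∀ j, (τ (dW j)).re < 0) :
    IsEmpty (PosIdx (cmXW L dV dW hdW ι₁ v)) ∨ IsEmpty (NegIdx (cmXW L dV dW hdW ι₁ v)) := by
  rcases forall_pos_or_forall_neg_div h (cmCW_ne_zero L dV ι₁ v) with h | h
  · exact Or.inr (isEmpty_negIdx fun j => by
      show 0 < placeSignVec (cmRealVec L dW hdW) (cmCW L dV ι₁) v j
      rw [placeSignVec_cmRealVec L v τ hτ dW hdW]; exact h j)
  · exact Or.inl (isEmpty_posIdx fun j => by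
      show placeSignVec (cmRealVec L dW hdW) (cmCW L dV ι₁) v j < 0
      rw [placeSignVec_cmRealVec L v τ hτ dW hdW]; exact h j)

/-- the complex place chosen over `v` is the place of its own embedding (as a `comap` identity). [folklore] -/
theorem comap_mk_embedding_cmPlaceOver (v : {v : InfinitePlace ↥(maximalRealSubfield L) // v.IsReal}) :
    (InfinitePlace.mk (cmPlaceOver L v).1.embedding).comap (algebraMap (↥(maximalRealSubfield L)) L) = v.1 := by
  rw [mk_embedding]; exact cmPlaceOver_comap L v

/-- **a hermitian LINE reads doubly definite at EVERY real place** (`M = 1`: one non-zero real number has a sign).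
[folklore] -/
theorem isEmpty_posIdx_or_negIdx_cmXW_lineVec (d : L) (hd : IsCMField.complexConj L d = d) (hd0 : d ≠ 0)
    (v : {v : InfinitePlace ↥(maximalRealSubfield L) // v.IsReal}) :
    IsEmpty (PosIdx (cmXW L dV (lineVec L d) (fun _ => hd) ι₁ v)) ∨
      IsEmpty (NegIdx (cmXW L dV (lineVec L d) (fun _ => hd) ι₁ v)) :=
  isEmpty_posIdx_or_negIdx_cmXW_of_signs L dV (lineVec L d) (fun _ => hd) ι₁ v (cmPlaceOver L v).1.embedding
    (comap_mk_embedding_cmPlaceOver L v) (lineVec_sign L (cmPlaceOver L v).1.embedding d hd hd0)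

/-- on `Fin 1` a non-empty positive block empties the non-positive block. [folklore] -/
theorem isEmpty_negIdx_of_nonempty_posIdx {y : Fin 1 → ℝ} (h : Nonempty (PosIdx y)) : IsEmpty (NegIdx y) :=
  ⟨fun q => q.2 (by obtain ⟨p⟩ := h; rw [Subsingleton.elim q.1 p.1]; exact p.2)⟩

end Generic

/-! ## §2 The line pair of a `HermSpace3`: the slot datum at every place -/

section Line

variable {L : CMField} {ι₁ : L →+* ℂ} (V : HermSpace3 L ι₁)
variable (d : (L : Type)) (hd : IsCMField.complexConj L d = d) (hd0 : d ≠ 0)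

/-- the place under `ι₁`, as the subtype inequality used by binder-2's definite-place lemmas. -/
theorem val_ne_comap_of_ne_cmPlace {v : {v : InfinitePlace ↥(maximalRealSubfield L) // v.IsReal}}
    (hv : v ≠ HypCensus.cmPlace (L : Type) ι₁) :
    v.1 ≠ (InfinitePlace.mk ι₁).comap (algebraMap (↥(maximalRealSubfield L)) L) :=
  fun h => hv (Subtype.ext h)

/-- **off `v₁` the `V`-side of the pin reads definite** (`V` is definite at every complex place away from `ι₁`). -/
theorem isEmpty_posIdx_or_negIdx_cmXV_frameD_of_ne (v : {v : InfinitePlace ↥(maximalRealSubfield L) // v.IsReal})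
    (hv : v ≠ HypCensus.cmPlace (L : Type) ι₁) :
    IsEmpty (PosIdx (cmXV (L : Type) (frameD V) (frameD_real V) ι₁ v)) ∨
      IsEmpty (NegIdx (cmXV (L : Type) (frameD V) (frameD_real V) ι₁ v)) :=
  isEmpty_posIdx_or_negIdx_placeSignVec (L : Type) (frameD V) (frameD_real V)
    (cmSignConv_ne_zero (L : Type) (frameD V) ι₁) ι₁ (frameD_sign_of_ne V) v (val_ne_comap_of_ne_cmPlace hv)

include hd0 in
/-- **the slot datum of the line pair OFF `v₁` — no hypothesis**: both sides read definite, the slot is a product of two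
compact unitary groups, and (SD) `exists_slotDatum_of_definite` is the datum. -/
theorem exists_lineSlotDatum_of_ne (v : {v : InfinitePlace ↥(maximalRealSubfield L) // v.IsReal})
    (hv : v ≠ HypCensus.cmPlace (L : Type) ι₁) :
    ∃ ω₁ : Representation ℂ
        (Ginf (PosIdx (cmXV (L : Type) (frameD V) (frameD_real V) ι₁ v)) (NegIdx (cmXV (L : Type) (frameD V) (frameD_real V) ι₁ v))
          (PosIdx (cmXW (L : Type) (frameD V) (lineVec (L : Type) d) (fun _ => hd) ι₁ v))
          (NegIdx (cmXW (L : Type) (frameD V) (lineVec (L : Type) d) (fun _ => hd) ι₁ v)))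
        (SchwartzMap (DPIdx (PosIdx (cmXV (L : Type) (frameD V) (frameD_real V) ι₁ v))
          (NegIdx (cmXV (L : Type) (frameD V) (frameD_real V) ι₁ v))
          (PosIdx (cmXW (L : Type) (frameD V) (lineVec (L : Type) d) (fun _ => hd) ι₁ v))
          (NegIdx (cmXW (L : Type) (frameD V) (lineVec (L : Type) d) (fun _ => hd) ι₁ v)) → ℝ) ℂ),
      IsArchWeilDatum (ι𝕎 _ _ _ _) ω₁ ∧ ∀ u, Continuous (ω₁ u) :=
  exists_slotDatum_of_definite (isEmpty_posIdx_or_negIdx_cmXV_frameD_of_ne V v hv)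
    (isEmpty_posIdx_or_negIdx_cmXW_lineVec (L : Type) (frameD V) ι₁ d hd hd0 v)

/-- **the slot datum of a POSITIVELY read line AT `v₁`**: the `V`-side reads `(2,1)` (binder-2's canonical frame
equivalences), the `W`-side `(1,0)`, and (SD) `exists_slotDatum_of_negCard` (K-1's explicit vacuum-overlap phase) is the
datum. -/
theorem exists_lineSlotDatum_cmPlace_of_pos
    (hR : Nonempty (PosIdx (cmXW (L : Type) (frameD V) (lineVec (L : Type) d) (fun _ => hd) ι₁ (HypCensus.cmPlace (L : Type) ι₁)))) :
    ∃ ω₁ : Representation ℂ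
        (Ginf (PosIdx (cmXV (L : Type) (frameD V) (frameD_real V) ι₁ (HypCensus.cmPlace (L : Type) ι₁)))
          (NegIdx (cmXV (L : Type) (frameD V) (frameD_real V) ι₁ (HypCensus.cmPlace (L : Type) ι₁)))
          (PosIdx (cmXW (L : Type) (frameD V) (lineVec (L : Type) d) (fun _ => hd) ι₁ (HypCensus.cmPlace (L : Type) ι₁)))
          (NegIdx (cmXW (L : Type) (frameD V) (lineVec (L : Type) d) (fun _ => hd) ι₁ (HypCensus.cmPlace (L : Type) ι₁))))
        (SchwartzMap (DPIdx (PosIdx (cmXV (L : Type) (frameD V) (frameD_real V) ι₁ (HypCensus.cmPlace (L : Type) ι₁)))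
          (NegIdx (cmXV (L : Type) (frameD V) (frameD_real V) ι₁ (HypCensus.cmPlace (L : Type) ι₁)))
          (PosIdx (cmXW (L : Type) (frameD V) (lineVec (L : Type) d) (fun _ => hd) ι₁ (HypCensus.cmPlace (L : Type) ι₁)))
          (NegIdx (cmXW (L : Type) (frameD V) (lineVec (L : Type) d) (fun _ => hd) ι₁ (HypCensus.cmPlace (L : Type) ι₁))) → ℝ) ℂ),
      IsArchWeilDatum (ι𝕎 _ _ _ _) ω₁ ∧ ∀ u, Continuous (ω₁ u) := by
  haveI := hR
  haveI := isEmpty_negIdx_of_nonempty_posIdx hR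
  haveI : Subsingleton (NegIdx (cmXV (L : Type) (frameD V) (frameD_real V) ι₁ (HypCensus.cmPlace (L : Type) ι₁))) :=
    (cmNegIdxEquivUnit (L : Type) (frameD V) (frameD_real V) ι₁ (frameD_sign_ι₁ V)).subsingleton
  exact exists_slotDatum_of_negCard
    ((cmPosIdxEquivFin (L : Type) (frameD V) (frameD_real V) ι₁ (frameD_sign_ι₁ V)).symm 0)
    ((cmNegIdxEquivUnit (L : Type) (frameD V) (frameD_real V) ι₁ (frameD_sign_ι₁ V)).symm ())

/-! ## §3 The place family `hslot` of the line pair, reduced to `v₁` / discharged -/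

include hd0 in
/-- **`hslot` REDUCES TO THE PLACE UNDER `ι₁`**: a small datum on the slot at `v₁` alone yields the whole place family
consumed by `placeVacExponents` / (CF)'s `lineVacExponents`. -/
theorem lineSlotFamily_of_cmPlace
    (h₁ : ∃ ω₁ : Representation ℂ
        (Ginf (PosIdx (cmXV (L : Type) (frameD V) (frameD_real V) ι₁ (HypCensus.cmPlace (L : Type) ι₁)))
          (NegIdx (cmXV (L : Type) (frameD V) (frameD_real V) ι₁ (HypCensus.cmPlace (L : Type) ι₁)))
          (PosIdx (cmXW (L : Type) (frameD V) (lineVec (L : Type) d) (fun _ => hd) ι₁ (HypCensus.cmPlace (L : Type) ι₁)))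
          (NegIdx (cmXW (L : Type) (frameD V) (lineVec (L : Type) d) (fun _ => hd) ι₁ (HypCensus.cmPlace (L : Type) ι₁))))
        (SchwartzMap (DPIdx (PosIdx (cmXV (L : Type) (frameD V) (frameD_real V) ι₁ (HypCensus.cmPlace (L : Type) ι₁)))
          (NegIdx (cmXV (L : Type) (frameD V) (frameD_real V) ι₁ (HypCensus.cmPlace (L : Type) ι₁)))
          (PosIdx (cmXW (L : Type) (frameD V) (lineVec (L : Type) d) (fun _ => hd) ι₁ (HypCensus.cmPlace (L : Type) ι₁)))
          (NegIdx (cmXW (L : Type) (frameD V) (lineVec (L : Type) d) (fun _ => hd) ι₁ (HypCensus.cmPlace (L : Type) ι₁))) → ℝ) ℂ),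
      IsArchWeilDatum (ι𝕎 _ _ _ _) ω₁ ∧ ∀ u, Continuous (ω₁ u)) :
    ∀ v : {v : InfinitePlace ↥(maximalRealSubfield L) // v.IsReal},
      ∃ ω₁ : Representation ℂ
          (Ginf (PosIdx (cmXV (L : Type) (frameD V) (frameD_real V) ι₁ v)) (NegIdx (cmXV (L : Type) (frameD V) (frameD_real V) ι₁ v))
            (PosIdx (cmXW (L : Type) (frameD V) (lineVec (L : Type) d) (fun _ => hd) ι₁ v))
            (NegIdx (cmXW (L : Type) (frameD V) (lineVec (L : Type) d) (fun _ => hd) ι₁ v)))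
          (SchwartzMap (DPIdx (PosIdx (cmXV (L : Type) (frameD V) (frameD_real V) ι₁ v))
            (NegIdx (cmXV (L : Type) (frameD V) (frameD_real V) ι₁ v))
            (PosIdx (cmXW (L : Type) (frameD V) (lineVec (L : Type) d) (fun _ => hd) ι₁ v))
            (NegIdx (cmXW (L : Type) (frameD V) (lineVec (L : Type) d) (fun _ => hd) ι₁ v)) → ℝ) ℂ),
        IsArchWeilDatum (ι𝕎 _ _ _ _) ω₁ ∧ ∀ u, Continuous (ω₁ u) := fun v => by
  by_cases hv : v = HypCensus.cmPlace (L : Type) ι₁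
  · subst hv; exact h₁
  · exact exists_lineSlotDatum_of_ne V d hd hd0 v hv

include hd0 in
/-- **`hslot` DISCHARGED for a positively read line.** -/
theorem lineSlotFamily_of_pos
    (hR : Nonempty (PosIdx (cmXW (L : Type) (frameD V) (lineVec (L : Type) d) (fun _ => hd) ι₁ (HypCensus.cmPlace (L : Type) ι₁)))) :
    ∀ v : {v : InfinitePlace ↥(maximalRealSubfield L) // v.IsReal},
      ∃ ω₁ : Representation ℂ
          (Ginf (PosIdx (cmXV (L : Type) (frameD V) (frameD_real V) ι₁ v)) (NegIdx (cmXV (L : Type) (frameD V) (frameD_real V) ι₁ v))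
            (PosIdx (cmXW (L : Type) (frameD V) (lineVec (L : Type) d) (fun _ => hd) ι₁ v))
            (NegIdx (cmXW (L : Type) (frameD V) (lineVec (L : Type) d) (fun _ => hd) ι₁ v)))
          (SchwartzMap (DPIdx (PosIdx (cmXV (L : Type) (frameD V) (frameD_real V) ι₁ v))
            (NegIdx (cmXV (L : Type) (frameD V) (frameD_real V) ι₁ v))
            (PosIdx (cmXW (L : Type) (frameD V) (lineVec (L : Type) d) (fun _ => hd) ι₁ v))
            (NegIdx (cmXW (L : Type) (frameD V) (lineVec (L : Type) d) (fun _ => hd) ι₁ v)) → ℝ) ℂ),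
        IsArchWeilDatum (ι𝕎 _ _ _ _) ω₁ ∧ ∀ u, Continuous (ω₁ u) :=
  lineSlotFamily_of_cmPlace V d hd hd0 (exists_lineSlotDatum_cmPlace_of_pos V d hd hR)

variable (hGRd : (cmSplittingDatum (L : Type) (e₁) (frameD V) (frameD_real V) (frameD_ne V) (lineVec (L : Type) d) (fun _ => hd)
    (fun _ => hd0)).CompatibleSplitting)

/-- (CF)'s line vacuum exponents from the single slot datum at `v₁`. -/
abbrev lineVacExponentsOfCmPlace
    (h₁ : ∃ ω₁ : Representation ℂ
        (Ginf (PosIdx (cmXV (L : Type) (frameD V) (frameD_real V) ι₁ (HypCensus.cmPlace (L : Type) ι₁)))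
          (NegIdx (cmXV (L : Type) (frameD V) (frameD_real V) ι₁ (HypCensus.cmPlace (L : Type) ι₁)))
          (PosIdx (cmXW (L : Type) (frameD V) (lineVec (L : Type) d) (fun _ => hd) ι₁ (HypCensus.cmPlace (L : Type) ι₁)))
          (NegIdx (cmXW (L : Type) (frameD V) (lineVec (L : Type) d) (fun _ => hd) ι₁ (HypCensus.cmPlace (L : Type) ι₁))))
        (SchwartzMap (DPIdx (PosIdx (cmXV (L : Type) (frameD V) (frameD_real V) ι₁ (HypCensus.cmPlace (L : Type) ι₁)))
          (NegIdx (cmXV (L : Type) (frameD V) (frameD_real V) ι₁ (HypCensus.cmPlace (L : Type) ι₁)))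
          (PosIdx (cmXW (L : Type) (frameD V) (lineVec (L : Type) d) (fun _ => hd) ι₁ (HypCensus.cmPlace (L : Type) ι₁)))
          (NegIdx (cmXW (L : Type) (frameD V) (lineVec (L : Type) d) (fun _ => hd) ι₁ (HypCensus.cmPlace (L : Type) ι₁))) → ℝ) ℂ),
      IsArchWeilDatum (ι𝕎 _ _ _ _) ω₁ ∧ ∀ u, Continuous (ω₁ u))
    (v : {v : InfinitePlace ↥(maximalRealSubfield L) // v.IsReal}) : VacExponents :=
  lineVacExponents V d hd hd0 hGRd (lineSlotFamily_of_cmPlace V d hd hd0 h₁) v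

/-- **the closed form of the line's centre character from the single slot datum at `v₁`** ((CF) with `hslot` reduced). -/
theorem coe_lineCenterChar_eq_prod_zpow_of_cmPlace
    (h₁ : ∃ ω₁ : Representation ℂ
        (Ginf (PosIdx (cmXV (L : Type) (frameD V) (frameD_real V) ι₁ (HypCensus.cmPlace (L : Type) ι₁)))
          (NegIdx (cmXV (L : Type) (frameD V) (frameD_real V) ι₁ (HypCensus.cmPlace (L : Type) ι₁)))
          (PosIdx (cmXW (L : Type) (frameD V) (lineVec (L : Type) d) (fun _ => hd) ι₁ (HypCensus.cmPlace (L : Type) ι₁)))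
          (NegIdx (cmXW (L : Type) (frameD V) (lineVec (L : Type) d) (fun _ => hd) ι₁ (HypCensus.cmPlace (L : Type) ι₁))))
        (SchwartzMap (DPIdx (PosIdx (cmXV (L : Type) (frameD V) (frameD_real V) ι₁ (HypCensus.cmPlace (L : Type) ι₁)))
          (NegIdx (cmXV (L : Type) (frameD V) (frameD_real V) ι₁ (HypCensus.cmPlace (L : Type) ι₁)))
          (PosIdx (cmXW (L : Type) (frameD V) (lineVec (L : Type) d) (fun _ => hd) ι₁ (HypCensus.cmPlace (L : Type) ι₁)))
          (NegIdx (cmXW (L : Type) (frameD V) (lineVec (L : Type) d) (fun _ => hd) ι₁ (HypCensus.cmPlace (L : Type) ι₁))) → ℝ) ℂ),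
      IsArchWeilDatum (ι𝕎 _ _ _ _) ω₁ ∧ ∀ u, Continuous (ω₁ u))
    (t : ↥(Literature.NumberTheory.Automorphic.relNormOneInfUnits (↥(maximalRealSubfield L)) L)) :
    ((lineCenterChar V d hd hd0 hGRd t : Circle) : ℂ) =
      ∏ v : {v : InfinitePlace ↥(maximalRealSubfield L) // v.IsReal},
        ((NumberField.archPlaceChar (L : Type) (cmPlaceOver (L : Type) v).1 t : Circle) : ℂ) ^
          ((Fintype.card (PosIdx (cmXV (L : Type) (frameD V) (frameD_real V) ι₁ v)) : ℤ) *
              (lineVacExponentsOfCmPlace V d hd hd0 hGRd h₁ v).eP +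
            (Fintype.card (NegIdx (cmXV (L : Type) (frameD V) (frameD_real V) ι₁ v)) : ℤ) *
              (lineVacExponentsOfCmPlace V d hd hd0 hGRd h₁ v).eQ) :=
  coe_lineCenterChar_eq_prod_zpow V d hd hd0 hGRd (lineSlotFamily_of_cmPlace V d hd hd0 h₁) t

/-- **the closed form of a POSITIVELY read line's centre character — UNCONDITIONAL** ((CF) with `hslot` discharged). -/
theorem coe_lineCenterChar_eq_prod_zpow_of_pos
    (hR : Nonempty (PosIdx (cmXW (L : Type) (frameD V) (lineVec (L : Type) d) (fun _ => hd) ι₁ (HypCensus.cmPlace (L : Type) ι₁))))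
    (t : ↥(Literature.NumberTheory.Automorphic.relNormOneInfUnits (↥(maximalRealSubfield L)) L)) :
    ((lineCenterChar V d hd hd0 hGRd t : Circle) : ℂ) =
      ∏ v : {v : InfinitePlace ↥(maximalRealSubfield L) // v.IsReal},
        ((NumberField.archPlaceChar (L : Type) (cmPlaceOver (L : Type) v).1 t : Circle) : ℂ) ^
          ((Fintype.card (PosIdx (cmXV (L : Type) (frameD V) (frameD_real V) ι₁ v)) : ℤ) *
              (lineVacExponentsOfCmPlace V d hd hd0 hGRd (exists_lineSlotDatum_cmPlace_of_pos V d hd hR) v).eP +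
            (Fintype.card (NegIdx (cmXV (L : Type) (frameD V) (frameD_real V) ι₁ v)) : ℤ) *
              (lineVacExponentsOfCmPlace V d hd hd0 hGRd (exists_lineSlotDatum_cmPlace_of_pos V d hd hR) v).eQ) :=
  coe_lineCenterChar_eq_prod_zpow_of_cmPlace V d hd hd0 hGRd (exists_lineSlotDatum_cmPlace_of_pos V d hd hR) t

/-! ## §4 In (F1)'s currency `hpos : 0 < x_W(v₁) 0` -/

/-- (F1)'s positivity condition `hpos` makes the positive `W`-block at `v₁` non-empty. -/
theorem nonempty_posIdx_of_hpos
    (hpos : 0 < cmXW (L : Type) (frameD V) (lineVec (L : Type) d) (fun _ => hd) ι₁ (HypCensus.cmPlace (L : Type) ι₁) 0) :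
    Nonempty (PosIdx (cmXW (L : Type) (frameD V) (lineVec (L : Type) d) (fun _ => hd) ι₁ (HypCensus.cmPlace (L : Type) ι₁))) :=
  ⟨⟨0, hpos⟩⟩

include hd0 in
/-- **`hslot` DISCHARGED under (F1)'s `hpos`** (the hypothesis text of `archLineDatumOf` / `linePhi`). -/
theorem lineSlotFamily_of_hpos
    (hpos : 0 < cmXW (L : Type) (frameD V) (lineVec (L : Type) d) (fun _ => hd) ι₁ (HypCensus.cmPlace (L : Type) ι₁) 0) :
    ∀ v : {v : InfinitePlace ↥(maximalRealSubfield L) // v.IsReal},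
      ∃ ω₁ : Representation ℂ
          (Ginf (PosIdx (cmXV (L : Type) (frameD V) (frameD_real V) ι₁ v)) (NegIdx (cmXV (L : Type) (frameD V) (frameD_real V) ι₁ v))
            (PosIdx (cmXW (L : Type) (frameD V) (lineVec (L : Type) d) (fun _ => hd) ι₁ v))
            (NegIdx (cmXW (L : Type) (frameD V) (lineVec (L : Type) d) (fun _ => hd) ι₁ v)))
          (SchwartzMap (DPIdx (PosIdx (cmXV (L : Type) (frameD V) (frameD_real V) ι₁ v))
            (NegIdx (cmXV (L : Type) (frameD V) (frameD_real V) ι₁ v))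
            (PosIdx (cmXW (L : Type) (frameD V) (lineVec (L : Type) d) (fun _ => hd) ι₁ v))
            (NegIdx (cmXW (L : Type) (frameD V) (lineVec (L : Type) d) (fun _ => hd) ι₁ v)) → ℝ) ℂ),
        IsArchWeilDatum (ι𝕎 _ _ _ _) ω₁ ∧ ∀ u, Continuous (ω₁ u) :=
  lineSlotFamily_of_pos V d hd hd0 (nonempty_posIdx_of_hpos V d hd hpos)

/-- **(F1)'s eigenvalue `lineC` in closed form under `hpos` alone** ((CF) `lineC_eq_prod_zpow_mul` with `hslot` discharged):
`lineC t = (∏_v ι_{w(v)}(t)^(|P_v|·e_P(v)+|Q_v|·e_Q(v))) · ι_{w(v₁)}(t)`. -/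
theorem lineC_eq_prod_zpow_mul_of_hpos
    (hpos : 0 < cmXW (L : Type) (frameD V) (lineVec (L : Type) d) (fun _ => hd) ι₁ (HypCensus.cmPlace (L : Type) ι₁) 0)
    (t : ↥(Literature.NumberTheory.Automorphic.relNormOneInfUnits (↥(maximalRealSubfield L)) L)) :
    lineC V d hd hd0 hGRd t =
      (∏ v : {v : InfinitePlace ↥(maximalRealSubfield L) // v.IsReal},
        ((NumberField.archPlaceChar (L : Type) (cmPlaceOver (L : Type) v).1 t : Circle) : ℂ) ^
          ((Fintype.card (PosIdx (cmXV (L : Type) (frameD V) (frameD_real V) ι₁ v)) : ℤ) *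
              (lineVacExponents V d hd hd0 hGRd (lineSlotFamily_of_hpos V d hd hd0 hpos) v).eP +
            (Fintype.card (NegIdx (cmXV (L : Type) (frameD V) (frameD_real V) ι₁ v)) : ℤ) *
              (lineVacExponents V d hd hd0 hGRd (lineSlotFamily_of_hpos V d hd hd0 hpos) v).eQ)) *
        ((NumberField.archPlaceChar (L : Type) (cmPlaceOver (L : Type) (HypCensus.cmPlace (L : Type) ι₁)).1 t : Circle) : ℂ) :=
  lineC_eq_prod_zpow_mul V d hd hd0 hGRd (lineSlotFamily_of_hpos V d hd hd0 hpos) t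

end Line

end HodgeCM.Model.ArchSideTerm

end
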